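import Literature.Computability.Cryptography.BLPRSMachineRejParams
import HarnessLib

/-!
# GPV's rejection sampler at `θ = n/A²` for an ARBITRARY `A` with `n ≤ A²`: parameters and a negligible distance

Topic `Computability/Cryptography` (LWE), grouping namespace `BLPRS2013`; generalisation of `BLPRSMachineRejParams.lean` (where `A = gridA c n`, the modulus
switch's grid base, with `A ≤ 3n`). The h₃ machine must ALSO sample the lattice noise `χ_N` of hybrid `ℬ₂` — `n` iid `D_{ℤ, Qr_N}` (`LWELatticeNoiseProduct.lean`,
`LWEHybridT2Law.lean`) — whose parameter `Q·r_N ≈ 2^{√n/2}` is EXPONENTIALLY larger than `n`: the rational `θ = n/A²` (so that `√(π/θ) = A√(π/n)`) then has an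
`A` far beyond `3n`, and the tail term of the grid-specific bound must be redone (the factor `1 + 1/(2θ(2ʷ−½))` is now `≈ A/(3n)`, still killed by `e^{−9n/4}`). This
file repeats the grid file's bookkeeping with `A` a free parameter (everything PROVED, definitions with bodies, no named fact; the small lemmas `rejS`, `rejN`, `rejP`,
`rejR`, `rejEta_le`, `lin_le_two_pow`, `one_sub_pow_le_exp_neg_mul`, `exp_neg_le_inv_two_pow` are reused from the grid file):

* `thetaA A n = n/A²`, `wA A = ⌊log₂ A⌋ + 2`, `mA A n = A/(2(⌊√n⌋+1))`, `cast_thetaA`, `thetaA_pos`, `thetaA_le_one`;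
* the hypotheses of `GaussRej.tvDist_rejLaw_le_of_params`: `window_boundsA`, `rejM_specA`, `rejM_lt_windowA`, `rejS_specA` (generic in `A`);
* `rej_accept_boundsA`, `rej_term1A`, `rej_term2A`, **`rej_term3_any`** (`≤ (6 + 2A)/2ⁿ`, no `A ≤ 3n`), **`tvDist_rejLaw_any_le`** (`≤ (7 + 50A)/2ⁿ` for `n ≥ 16`), and
  **`eventually_rejLaw_any_le_pow`** (for `A : ℕ → ℕ` with `n ≤ A(n)²` and `A(n) ≤ √2ⁿ` eventually: `≤ 1/nᵏ` eventually, uniformly in the centre).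

## References

* C. Gentry, C. Peikert, V. Vaikuntanathan, *Trapdoors for hard lattices and new cryptographic constructions*, STOC 2008, §4.1 and Lemma 4.2.
  [GentryPeikertVaikuntanathan2008]
* Z. Brakerski, A. Langlois, C. Peikert, O. Regev, D. Stehlé, *Classical hardness of learning with errors*, STOC 2013; arXiv:1306.0281, Lemma 2.3 and §5.
  [BrakerskiEtAl2013]
-/

noncomputable section

open Filter Literature.Algebra.EuclideanLattices Literature.Probability.Distributions
open scoped Real

namespace Literature.Computability.Cryptography

namespace BLPRS2013

/-! ### The parameters -/

/-- **The rational `θ = n/A²`** (so that `√(π/θ) = A·√(π/n)`). [cite: GentryPeikertVaikuntanathan2008, §4.1] -/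
def thetaA (A n : ℕ) : ℚ := (n : ℚ) / ((A : ℚ) ^ 2)

/-- **Window exponent** `w = ⌊log₂ A⌋ + 2`. [cite: GentryPeikertVaikuntanathan2008, §4.1] -/
def wA (A : ℕ) : ℕ := Nat.log 2 A + 2

/-- **Acceptance count** `m = A/(2(⌊√n⌋+1))`. [cite: GentryPeikertVaikuntanathan2008, Lemma 4.2] -/
def mA (A n : ℕ) : ℕ := A / (2 * (Nat.sqrt n + 1))

/-- `θ` as a real. [folklore] -/
theorem cast_thetaA (A n : ℕ) : ((thetaA A n : ℚ) : ℝ) = (n : ℝ) / (A : ℝ) ^ 2 := by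
  unfold thetaA; push_cast; rfl

/-- `0 < θ` for `0 < n`, `0 < A`. [folklore] -/
theorem thetaA_pos {A n : ℕ} (hApos : 0 < A) (hn : 0 < n) : 0 < thetaA A n := by
  unfold thetaA
  have : (0 : ℚ) < A := by exact_mod_cast hApos
  have : (0 : ℚ) < n := by exact_mod_cast hn
  positivity

/-- `θ ≤ 1` when `n ≤ A²`. [folklore] -/
theorem thetaA_le_one {A n : ℕ} (hApos : 0 < A) (hAn : n ≤ A ^ 2) : thetaA A n ≤ 1 := by
  unfold thetaA
  have hA : (0 : ℚ) < (A : ℚ) ^ 2 := by positivity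
  rw [div_le_one hA]
  exact_mod_cast hAn

/-! ### The hypotheses of the rejection-sampler bound, generic in `A` -/

section Facts

/-- `2A < 2ʷ ≤ 4A`. [folklore] -/
theorem window_boundsA {A : ℕ} (hApos : 0 < A) : 2 * A < 2 ^ wA A ∧ 2 ^ wA A ≤ 4 * A := by
  have hA : 0 < A := hApos
  have h1 : A < 2 ^ (Nat.log 2 (A) + 1) := Nat.lt_pow_succ_log_self (by norm_num) _
  have h2 : 2 ^ Nat.log 2 (A) ≤ A := Nat.pow_log_le_self 2 hA.ne'
  unfold wA
  constructor
  · calc 2 * A < 2 * 2 ^ (Nat.log 2 (A) + 1) := by omega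
      _ = 2 ^ (Nat.log 2 (A) + 2) := by ring
  · calc 2 ^ (Nat.log 2 (A) + 2) = 4 * 2 ^ Nat.log 2 (A) := by ring
      _ ≤ 4 * A := by omega


/-- `√n ≤ A` (indeed `n ≤ A²`). [folklore] -/
theorem sqrt_le_A {A n : ℕ} (hAn : n ≤ A ^ 2) : Real.sqrt n ≤ A := by
  rw [Real.sqrt_le_left (Nat.cast_nonneg _)]
  exact_mod_cast hAn


/-- `m ≤ A/(2√n)` as reals (`⌊√n⌋ + 1 ≥ √n`). [folklore] -/
theorem rejM_leA {A n : ℕ} (hn : 0 < n) : (mA A n : ℝ) ≤ A / (2 * Real.sqrt n) := by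
  have hn' : (0 : ℝ) < n := by exact_mod_cast hn
  have hs : Real.sqrt n ≤ (Nat.sqrt n : ℝ) + 1 := by
    have h := Nat.lt_succ_sqrt' n
    have h' : (n : ℝ) < ((Nat.sqrt n : ℝ) + 1) ^ 2 := by exact_mod_cast h
    rw [Real.sqrt_le_left (by positivity)]
    exact h'.le
  have hdiv : (mA A n : ℝ) ≤ (A : ℝ) / (2 * ((Nat.sqrt n : ℝ) + 1)) := by
    unfold mA
    rw [le_div_iff₀ (by positivity)]
    have := Nat.div_mul_le_self (A) (2 * (Nat.sqrt n + 1))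
    exact_mod_cast this
  refine hdiv.trans ?_
  exact div_le_div_of_nonneg_left (Nat.cast_nonneg _) (by positivity) (by linarith)


/-- `m + 1 ≥ A/(2(⌊√n⌋+1))`. [folklore] -/
theorem rejM_add_one_geA (A n : ℕ) : (A : ℝ) / (2 * ((Nat.sqrt n : ℝ) + 1)) ≤ (mA A n : ℝ) + 1 := by
  unfold mA
  have hpos : (0 : ℝ) < 2 * ((Nat.sqrt n : ℝ) + 1) := by positivity
  rw [div_le_iff₀ hpos]
  have h := Nat.lt_div_mul_add (a := A) (b := 2 * (Nat.sqrt n + 1)) (by positivity)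
  have h' : (A : ℝ) < ((A / (2 * (Nat.sqrt n + 1)) : ℕ) : ℝ) * (2 * ((Nat.sqrt n : ℝ) + 1)) + (2 * ((Nat.sqrt n : ℝ) + 1)) := by
    exact_mod_cast h
  nlinarith


/-- **`θ(m+½)² ≤ 1`.** [cite: GentryPeikertVaikuntanathan2008, Lemma 4.2] -/
theorem rejM_specA {A n : ℕ} (hApos : 0 < A) (hAn : n ≤ A ^ 2) (hn : 0 < n) : ((thetaA A n : ℚ) : ℝ) * ((mA A n : ℝ) + 1 / 2) ^ 2 ≤ 1 := by
  have hn' : (0 : ℝ) < n := by exact_mod_cast hn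
  have hA : (0 : ℝ) < A := by exact_mod_cast hApos
  have hsn : 0 < Real.sqrt n := Real.sqrt_pos.2 hn'
  have hm := rejM_leA (A := A) hn
  have hAs : Real.sqrt n ≤ A := sqrt_le_A hAn
  -- `m + ½ ≤ A/√n`
  have hm' : (mA A n : ℝ) + 1 / 2 ≤ A / Real.sqrt n := by
    have h1 : (A : ℝ) / (2 * Real.sqrt n) + 1 / 2 ≤ A / Real.sqrt n := by
      rw [div_add' _ _ _ (by positivity), div_le_div_iff₀ (by positivity) hsn]
      nlinarith
    linarith
  rw [cast_thetaA A n]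
  have hm0 : 0 ≤ (mA A n : ℝ) + 1 / 2 := by positivity
  calc (n : ℝ) / (A : ℝ) ^ 2 * ((mA A n : ℝ) + 1 / 2) ^ 2 ≤ (n : ℝ) / (A : ℝ) ^ 2 * (A / Real.sqrt n) ^ 2 := by
        gcongr
    _ = 1 := by
        rw [div_pow, Real.sq_sqrt hn'.le]
        field_simp


/-- **`m + 1 ≤ 2ʷ`.** [folklore] -/
theorem rejM_lt_windowA {A : ℕ} (hApos : 0 < A) (n : ℕ) : mA A n + 1 ≤ 2 ^ wA A := by
  have h1 : mA A n ≤ A := Nat.div_le_self _ _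
  have h2 := (window_boundsA hApos).1
  omega


/-- **`θ(2ʷ+½)² ≤ 2ˢ`** (`θ ≤ n/A²`, `2ʷ ≤ 4A`, `2ˢ > 32n`). [folklore] -/
theorem rejS_specA {A n : ℕ} (hApos : 0 < A) (hn : 0 < n) : ((thetaA A n : ℚ) : ℝ) * ((2 : ℝ) ^ wA A + 1 / 2) ^ 2 ≤ (2 : ℝ) ^ rejS n := by
  have hn' : (0 : ℝ) < n := by exact_mod_cast hn
  have hA : (0 : ℝ) < A := by exact_mod_cast hApos
  have hA1 : (1 : ℝ) ≤ A := by exact_mod_cast hApos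
  have hw : ((2 : ℝ) ^ wA A) ≤ 4 * A := by exact_mod_cast (window_boundsA hApos).2
  have hs : (32 : ℝ) * n < (2 : ℝ) ^ rejS n := by
    have h := Nat.lt_pow_succ_log_self (b := 2) (by norm_num) n
    have h' : (n : ℝ) < (2 : ℝ) ^ (Nat.log 2 n + 1) := by exact_mod_cast h
    unfold rejS
    rw [show Nat.log 2 n + 6 = (Nat.log 2 n + 1) + 5 by omega, pow_add]
    norm_num
    linarith
  rw [cast_thetaA A n]
  have hsq : ((2 : ℝ) ^ wA A + 1 / 2) ^ 2 ≤ (9 / 2 * A) ^ 2 := by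
    apply pow_le_pow_left₀ (by positivity)
    linarith
  calc (n : ℝ) / (A : ℝ) ^ 2 * ((2 : ℝ) ^ wA A + 1 / 2) ^ 2 ≤ (n : ℝ) / (A : ℝ) ^ 2 * (9 / 2 * A) ^ 2 := by
        gcongr
    _ = 81 / 4 * (n : ℝ) := by field_simp; norm_num
    _ ≤ (2 : ℝ) ^ rejS n := by linarith


/-- **The acceptance probability per round is `≥ 1/(96(⌊√n⌋+1))`** (and `≤ 1`), `n ≥ 16`:
`(m+1)e^{-1}/2^{w+1} ≥ (A/(2(⌊√n⌋+1)))/(3·8A) = 1/(48(⌊√n⌋+1))` and `η ≤ 2^{-n+1} ≤ 1/(96(⌊√n⌋+1))`.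
[cite: GentryPeikertVaikuntanathan2008, Lemma 4.2 (acceptance probability of SampleZ)] -/
theorem rej_accept_boundsA {A n : ℕ} (hApos : 0 < A) (hn : 16 ≤ n) :
    1 / (96 * ((Nat.sqrt n : ℝ) + 1)) ≤ ((mA A n : ℝ) + 1) * Real.exp (-1) / 2 ^ (wA A + 1) -
        ((2 : ℝ) ^ (rejS n + 1) / (rejN n).factorial + 1 / 2 ^ rejP n) ∧
      ((mA A n : ℝ) + 1) * Real.exp (-1) / 2 ^ (wA A + 1) -
        ((2 : ℝ) ^ (rejS n + 1) / (rejN n).factorial + 1 / 2 ^ rejP n) ≤ 1 := by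
  have hA : (0 : ℝ) < A := by exact_mod_cast hApos
  obtain ⟨hw1, hw2⟩ := window_boundsA hApos
  have hw2' : ((2 : ℝ) ^ wA A) ≤ 4 * A := by exact_mod_cast hw2
  set η : ℝ := (2 : ℝ) ^ (rejS n + 1) / (rejN n).factorial + 1 / 2 ^ rejP n with hηdef
  have hη0 : 0 ≤ η := by rw [hηdef]; positivity
  have hηle : η ≤ 2 / (2 : ℝ) ^ n := rejEta_le n
  have h2n : (0 : ℝ) < (2 : ℝ) ^ n := by positivity
  have he1 : Real.exp 1 ≤ 3 := le_of_lt (lt_trans Real.exp_one_lt_d9 (by norm_num))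
  have hem1 : 1 / 3 ≤ Real.exp (-1) := by
    rw [Real.exp_neg, one_div]
    exact inv_anti₀ (Real.exp_pos 1) he1
  set mR : ℝ := (mA A n : ℝ) with hmRdef
  have hm1 : (A : ℝ) / (2 * ((Nat.sqrt n : ℝ) + 1)) ≤ mR + 1 := rejM_add_one_geA A n
  have hsq1 : (0 : ℝ) < (Nat.sqrt n : ℝ) + 1 := by positivity
  constructor
  · have h1 : 1 / (16 * ((Nat.sqrt n : ℝ) + 1)) ≤ (mR + 1) / 2 ^ (wA A + 1) := by
      rw [pow_succ, div_le_div_iff₀ (by positivity) (by positivity)]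
      calc 1 * ((2 : ℝ) ^ wA A * 2) ≤ 8 * A := by linarith
        _ = (A / (2 * ((Nat.sqrt n : ℝ) + 1))) * (16 * ((Nat.sqrt n : ℝ) + 1)) := by field_simp; ring
        _ ≤ (mR + 1) * (16 * ((Nat.sqrt n : ℝ) + 1)) := mul_le_mul_of_nonneg_right hm1 (by positivity)
    have h2 : 1 / (48 * ((Nat.sqrt n : ℝ) + 1)) ≤ (mR + 1) * Real.exp (-1) / 2 ^ (wA A + 1) := by
      rw [mul_div_right_comm]
      calc 1 / (48 * ((Nat.sqrt n : ℝ) + 1)) = 1 / (16 * ((Nat.sqrt n : ℝ) + 1)) * (1 / 3) := by field_simp; ring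
        _ ≤ (mR + 1) / 2 ^ (wA A + 1) * Real.exp (-1) := mul_le_mul h1 hem1 (by norm_num) (by positivity)
    have h3 : η ≤ 1 / (96 * ((Nat.sqrt n : ℝ) + 1)) := by
      refine hηle.trans ?_
      rw [div_le_div_iff₀ h2n (by positivity)]
      have hs : (Nat.sqrt n : ℝ) ≤ n := by exact_mod_cast Nat.sqrt_le_self n
      have hlin := lin_le_two_pow hn
      nlinarith
    have e : 1 / (48 * ((Nat.sqrt n : ℝ) + 1)) = 2 * (1 / (96 * ((Nat.sqrt n : ℝ) + 1))) := by field_simp; norm_num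
    linarith
  · have h1 : (mR + 1) / 2 ^ (wA A + 1) ≤ 1 := by
      rw [div_le_one (by positivity)]
      have : (mA A n : ℝ) + 1 ≤ (2 : ℝ) ^ wA A := by exact_mod_cast rejM_lt_windowA hApos n
      have h2w : (2 : ℝ) ^ wA A ≤ 2 ^ (wA A + 1) := pow_le_pow_right₀ (by norm_num) (by omega)
      linarith
    have h2 : Real.exp (-1) ≤ 1 := by
      rw [Real.exp_neg]
      exact inv_le_one_of_one_le₀ (by linarith [Real.add_one_le_exp (1 : ℝ)])
    have : (mR + 1) * Real.exp (-1) / 2 ^ (wA A + 1) ≤ 1 := by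
      rw [mul_div_right_comm]
      calc (mR + 1) / 2 ^ (wA A + 1) * Real.exp (-1) ≤ 1 * 1 := mul_le_mul h1 h2 (Real.exp_pos _).le (by norm_num)
        _ = 1 := by ring
    linarith


/-- **Term 1**: `R = 96(⌊√n⌋+1)n` rounds all fail with probability `≤ e^{-n} ≤ 2^{-n}`. [cite: GentryPeikertVaikuntanathan2008, Lemma 4.2] -/
theorem rej_term1A {A n : ℕ} (hApos : 0 < A) (hn : 16 ≤ n) :
    (1 - (((mA A n : ℝ) + 1) * Real.exp (-1) / 2 ^ (wA A + 1) -
        ((2 : ℝ) ^ (rejS n + 1) / (rejN n).factorial + 1 / 2 ^ rejP n))) ^ rejR n ≤ 1 / (2 : ℝ) ^ n := by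
  obtain ⟨hp₀, hp₁⟩ := rej_accept_boundsA hApos hn
  set p : ℝ := ((mA A n : ℝ) + 1) * Real.exp (-1) / 2 ^ (wA A + 1) -
    ((2 : ℝ) ^ (rejS n + 1) / (rejN n).factorial + 1 / 2 ^ rejP n) with hpdef
  refine (one_sub_pow_le_exp_neg_mul hp₁ (rejR n)).trans ?_
  have hR : (rejR n : ℝ) = 96 * ((Nat.sqrt n : ℝ) + 1) * n := by unfold rejR; push_cast; ring
  have hpR : (n : ℝ) ≤ p * rejR n := by
    rw [hR]
    have hsq1 : (0 : ℝ) < (Nat.sqrt n : ℝ) + 1 := by positivity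
    calc (n : ℝ) = 1 / (96 * ((Nat.sqrt n : ℝ) + 1)) * (96 * ((Nat.sqrt n : ℝ) + 1) * n) := by field_simp
      _ ≤ p * (96 * ((Nat.sqrt n : ℝ) + 1) * n) := mul_le_mul_of_nonneg_right hp₀ (by positivity)
  exact (Real.exp_le_exp.2 (by linarith)).trans (exp_neg_le_inv_two_pow n)


/-- **Term 2**: `e·2^{w+1}·η/(m+1) ≤ 48A·2^{-n}`. [folklore] -/
theorem rej_term2A {A : ℕ} (hApos : 0 < A) (n : ℕ) :
    Real.exp 1 * 2 ^ (wA A + 1) * ((2 : ℝ) ^ (rejS n + 1) / (rejN n).factorial + 1 / 2 ^ rejP n) / ((mA A n : ℝ) + 1) ≤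
      48 * (A : ℝ) / (2 : ℝ) ^ n := by
  have hw2' : ((2 : ℝ) ^ wA A) ≤ 4 * A := by exact_mod_cast (window_boundsA hApos).2
  have hηle := rejEta_le n
  have he1 : Real.exp 1 ≤ 3 := le_of_lt (lt_trans Real.exp_one_lt_d9 (by norm_num))
  have hη0 : (0 : ℝ) ≤ (2 : ℝ) ^ (rejS n + 1) / (rejN n).factorial + 1 / 2 ^ rejP n := by positivity
  have hm1' : (1 : ℝ) ≤ (mA A n : ℝ) + 1 := by
    have := Nat.cast_nonneg (α := ℝ) (mA A n); linarith
  have hnum : Real.exp 1 * 2 ^ (wA A + 1) * ((2 : ℝ) ^ (rejS n + 1) / (rejN n).factorial + 1 / 2 ^ rejP n) ≤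
      48 * (A : ℝ) / (2 : ℝ) ^ n := by
    have h1 : Real.exp 1 * 2 ^ (wA A + 1) ≤ 3 * (8 * A) := by
      rw [pow_succ]
      exact mul_le_mul he1 (by linarith) (by positivity) (by norm_num)
    calc Real.exp 1 * 2 ^ (wA A + 1) * ((2 : ℝ) ^ (rejS n + 1) / (rejN n).factorial + 1 / 2 ^ rejP n)
        ≤ (3 * (8 * A)) * (2 / (2 : ℝ) ^ n) := mul_le_mul h1 hηle hη0 (by positivity)
      _ = 48 * (A : ℝ) / (2 : ℝ) ^ n := by ring
  calc Real.exp 1 * 2 ^ (wA A + 1) * ((2 : ℝ) ^ (rejS n + 1) / (rejN n).factorial + 1 / 2 ^ rejP n) / ((mA A n : ℝ) + 1)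
      ≤ Real.exp 1 * 2 ^ (wA A + 1) * ((2 : ℝ) ^ (rejS n + 1) / (rejN n).factorial + 1 / 2 ^ rejP n) / 1 :=
        div_le_div_of_nonneg_left (by positivity) one_pos hm1'
    _ ≤ 48 * (A : ℝ) / (2 : ℝ) ^ n := by rw [div_one]; exact hnum


/-- **Term 3** (the tail beyond the window), WITHOUT `A ≤ 3n`: `2e·e^{-θ(2ʷ-½)²}(1 + 1/(2θ(2ʷ-½))) ≤ (6 + 2A)/2ⁿ`
(`2ʷ - ½ ≥ 3A/2`, `θ(2ʷ-½)² ≥ 9n/4`, `1/(2θ(2ʷ-½)) ≤ A/(3n) ≤ A/3`, `e^{-9n/4} ≤ 2^{-n}`). [folklore] -/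
theorem rej_term3_any {A n : ℕ} (hApos : 0 < A) (hn : 0 < n) :
    Real.exp 1 * (2 * Real.exp (-((thetaA A n : ℝ) * ((2 : ℝ) ^ wA A - 1 / 2) ^ 2)) *
      (1 + 1 / (2 * (thetaA A n : ℝ) * ((2 : ℝ) ^ wA A - 1 / 2)))) ≤ (6 + 2 * (A : ℝ)) / (2 : ℝ) ^ n := by
  have hn' : (0 : ℝ) < n := by exact_mod_cast hn
  have hn1 : (1 : ℝ) ≤ n := by exact_mod_cast hn
  have hA : (0 : ℝ) < A := by exact_mod_cast hApos
  have hw1' : 2 * (A : ℝ) < (2 : ℝ) ^ wA A := by exact_mod_cast (window_boundsA hApos).1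
  have he1 : Real.exp 1 ≤ 3 := le_of_lt (lt_trans Real.exp_one_lt_d9 (by norm_num))
  have hA1 : (1 : ℝ) ≤ A := by exact_mod_cast hApos
  have hx : 3 / 2 * (A : ℝ) ≤ (2 : ℝ) ^ wA A - 1 / 2 := by linarith
  have hx0 : (0 : ℝ) < (2 : ℝ) ^ wA A - 1 / 2 := lt_of_lt_of_le (by positivity) hx
  have hθ : ((thetaA A n : ℚ) : ℝ) = (n : ℝ) / (A : ℝ) ^ 2 := cast_thetaA A n
  have hθ0 : (0 : ℝ) < (thetaA A n : ℝ) := by rw [hθ]; positivity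
  have hexp_arg : (n : ℝ) ≤ (thetaA A n : ℝ) * ((2 : ℝ) ^ wA A - 1 / 2) ^ 2 := by
    have h1 : (n : ℝ) ≤ (thetaA A n : ℝ) * (3 / 2 * A) ^ 2 := by
      rw [hθ, div_mul_eq_mul_div, le_div_iff₀ (by positivity)]
      nlinarith
    exact h1.trans (mul_le_mul_of_nonneg_left (pow_le_pow_left₀ (by positivity) hx 2) hθ0.le)
  -- `1/(2θx) ≤ A/3`
  have hinv : 1 / (2 * (thetaA A n : ℝ) * ((2 : ℝ) ^ wA A - 1 / 2)) ≤ (A : ℝ) / 3 := by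
    rw [div_le_div_iff₀ (by positivity) (by norm_num), one_mul]
    have h1 : (3 : ℝ) ≤ 2 * (thetaA A n : ℝ) * (3 / 2 * A) * A := by
      rw [hθ]
      have e : 2 * ((n : ℝ) / (A : ℝ) ^ 2) * (3 / 2 * A) * A = 3 * n := by field_simp
      rw [e]
      linarith
    calc (3 : ℝ) ≤ 2 * (thetaA A n : ℝ) * (3 / 2 * A) * A := h1
      _ ≤ 2 * (thetaA A n : ℝ) * ((2 : ℝ) ^ wA A - 1 / 2) * A := by gcongr
      _ = (A : ℝ) * (2 * (thetaA A n : ℝ) * ((2 : ℝ) ^ wA A - 1 / 2)) := by ring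
  have hfac : 1 + 1 / (2 * (thetaA A n : ℝ) * ((2 : ℝ) ^ wA A - 1 / 2)) ≤ 1 + (A : ℝ) / 3 := by linarith
  have hexp : Real.exp (-((thetaA A n : ℝ) * ((2 : ℝ) ^ wA A - 1 / 2) ^ 2)) ≤ 1 / (2 : ℝ) ^ n :=
    (Real.exp_le_exp.2 (by linarith)).trans (exp_neg_le_inv_two_pow n)
  have hfac0 : 0 ≤ 1 + 1 / (2 * (thetaA A n : ℝ) * ((2 : ℝ) ^ wA A - 1 / 2)) := by positivity
  calc Real.exp 1 * (2 * Real.exp (-((thetaA A n : ℝ) * ((2 : ℝ) ^ wA A - 1 / 2) ^ 2)) *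
        (1 + 1 / (2 * (thetaA A n : ℝ) * ((2 : ℝ) ^ wA A - 1 / 2))))
      ≤ 3 * (2 * (1 / (2 : ℝ) ^ n) * (1 + (A : ℝ) / 3)) := by
        refine mul_le_mul he1 ?_ (by positivity) (by norm_num)
        exact mul_le_mul (mul_le_mul_of_nonneg_left hexp (by norm_num)) hfac hfac0 (by positivity)
    _ = (6 + 2 * (A : ℝ)) / (2 : ℝ) ^ n := by ring

/-- **The rejection sampler at `θ = n/A²` is `(7 + 50A)·2^{-n}`-close to `D_{ℤ,√(π/θ),c'}`** for `n ≥ 16`, `n ≤ A²`, uniformly in the centre.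
[cite: GentryPeikertVaikuntanathan2008, Lemma 4.2; BrakerskiEtAl2013, §5] -/
theorem tvDist_rejLaw_any_le {A n : ℕ} (hApos : 0 < A) (hAn : n ≤ A ^ 2) (hn : 16 ≤ n) (c' : ℚ) :
    (GaussRej.rejLaw (thetaA A n) c' (rejS n) (rejN n) (rejP n) (wA A) (rejR n)).tvDist
        (discreteGaussianInt (Real.sqrt (π / (thetaA A n : ℝ))) c') ≤ (7 + 50 * (A : ℝ)) / (2 : ℝ) ^ n := by
  have hn0 : 0 < n := by omega
  have hbound := GaussRej.tvDist_rejLaw_le_of_params (thetaA_pos hApos hn0) (thetaA_le_one hApos hAn) c' (rejP n) (wA A)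
    (rejR n) (m := mA A n) (s := rejS n) (N := rejN n) (by unfold rejN; omega) (rejS_specA hApos hn0) (rejM_specA hApos hAn hn0)
    (rejM_lt_windowA hApos n) (rejEta_le_half (by omega))
  refine hbound.trans ?_
  have h1 := rej_term1A hApos hn
  have h2 := rej_term2A hApos n
  have h3 := rej_term3_any hApos hn0
  have h2n : (0 : ℝ) < (2 : ℝ) ^ n := by positivity
  have : 1 / (2 : ℝ) ^ n + 48 * (A : ℝ) / (2 : ℝ) ^ n + (6 + 2 * (A : ℝ)) / (2 : ℝ) ^ n = (7 + 50 * (A : ℝ)) / (2 : ℝ) ^ n := by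
    field_simp; ring
  linarith

/-- **… hence negligible along any `A(n)` with `n ≤ A(n)²` and `A(n) ≤ √2ⁿ` eventually**: for every `k`, eventually `Δ ≤ 1/n^k` for all centres.
[cite: BrakerskiEtAl2013, §5] -/
theorem eventually_rejLaw_any_le_pow (A : ℕ → ℕ) (hsq : ∀ n, n ≤ A n ^ 2) (hApos : ∀ n, 0 < A n)
    (hA : ∀ᶠ n : ℕ in atTop, (A n : ℝ) ≤ Real.sqrt 2 ^ n) (k : ℕ) :
    ∀ᶠ n : ℕ in atTop, ∀ c' : ℚ,
      (GaussRej.rejLaw (thetaA (A n) n) c' (rejS n) (rejN n) (rejP n) (wA (A n)) (rejR n)).tvDist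
        (discreteGaussianInt (Real.sqrt (π / (thetaA (A n) n : ℝ))) c') ≤ 1 / (n : ℝ) ^ k := by
  -- `57 n^k ≤ √2ⁿ` eventually, so `(7 + 50A) n^k ≤ 57 A n^k ≤ √2ⁿ·√2ⁿ = 2ⁿ`
  have hpoly : ∀ᶠ n : ℕ in atTop, 57 * (n : ℝ) ^ k ≤ Real.sqrt 2 ^ n := by
    have hlt : (1 : ℝ) < Real.sqrt 2 := by
      rw [show (1 : ℝ) = Real.sqrt 1 from Real.sqrt_one.symm]
      exact Real.sqrt_lt_sqrt (by norm_num) (by norm_num)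
    have h := tendsto_pow_const_div_const_pow_of_one_lt k hlt
    have h2 : ∀ᶠ m : ℕ in atTop, (m : ℝ) ^ k / Real.sqrt 2 ^ m ≤ 1 / 57 := h.eventually (ge_mem_nhds (by norm_num : (0 : ℝ) < 1 / 57))
    filter_upwards [h2] with n hn
    rw [div_le_div_iff₀ (by positivity) (by norm_num), one_mul] at hn
    linarith
  filter_upwards [hpoly, hA, eventually_ge_atTop 16] with n hpn hAn h16 c'
  have hn1 : (1 : ℝ) ≤ n := by exact_mod_cast (by omega : 1 ≤ n)
  have hA1 : (1 : ℝ) ≤ A n := by exact_mod_cast hApos n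
  refine (tvDist_rejLaw_any_le (hApos n) (hsq n) h16 c').trans ?_
  rw [div_le_div_iff₀ (by positivity) (by positivity), one_mul]
  have hsq2 : Real.sqrt 2 ^ n * Real.sqrt 2 ^ n = (2 : ℝ) ^ n := by
    rw [← mul_pow, Real.mul_self_sqrt (by norm_num)]
  have hnk : (0 : ℝ) ≤ (n : ℝ) ^ k := by positivity
  calc (7 + 50 * (A n : ℝ)) * (n : ℝ) ^ k ≤ (57 * (A n : ℝ)) * (n : ℝ) ^ k := by
        apply mul_le_mul_of_nonneg_right _ hnk; linarith
    _ = (A n : ℝ) * (57 * (n : ℝ) ^ k) := by ring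
    _ ≤ Real.sqrt 2 ^ n * Real.sqrt 2 ^ n := mul_le_mul hAn hpn (by positivity) (by positivity)
    _ = (2 : ℝ) ^ n := hsq2

end Facts

end BLPRS2013

end Literature.Computability.Cryptography

end
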